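import Mathlib
import Summits.Ventures.PercRepro2.Defs
import Summits.Ventures.PercRepro2.Graph
import Summits.Ventures.PercRepro2.OneColourSwitch
import Summits.Ventures.PercRepro2.RegionHubSign
import Summits.Ventures.PercRepro2.SideSwitch
import Summits.Ventures.PercRepro2.SideSwitchComps
import Summits.Ventures.PercRepro2.M9NoPocketDefs
import Summits.Ventures.PercRepro2.M9GeneralDSplit
import Summits.Ventures.PercRepro2.M9GeneralDHD
import Summits.Ventures.PercRepro2.M9PocketUnitKonly
import Summits.Ventures.PercRepro2.M9PocketRSEdgeTransfer
import Summits.Ventures.PercRepro2.M9PocketRootOnlyTransfer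
import Summits.Ventures.PercRepro2.M9PocketRSDTransfer
import Summits.Ventures.PercRepro2.M9PocketRSDJoin
import Summits.Ventures.PercRepro2.M9PocketRSDWorlds
import Summits.Ventures.PercRepro2.M9PocketRSDGlue
import Summits.Ventures.PercRepro2.M9PocketRSDSum
import Summits.Ventures.PercRepro2.M9PocketProdAssemblyT
import Summits.Ventures.PercRepro2.M9PocketProdWeightT
import Summits.Ventures.PercRepro2.M9PocketVirtualEdge
import Summits.Ventures.PercRepro2.M9PocketVirtualKonly
import Summits.Ventures.PercRepro2.M9PocketRSDOutside
import Summits.Ventures.PercRepro2.M9PocketRSDSymbols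

/-!
# A cluster hanging from `{r, s, d}` — the inner sums by class, I (blind cell PercRepro2, p3 g42,
2026-08-30; `proofs/P3-POCKETRK.md` §10⁶ (b)–(d))

For a fixed admissible cluster colouring `τ`, the inner sum of `hdK_eq_sum_rsd` over the
outside colourings is one of the five symbols of `M9PocketRSDSymbols` (with `δ` := the dead
end inside `F`), minus the `W`-link indicator times another, according to the `Y_F`-partition
of the exits: class `∅` (`Y − [w]·X`), `rs` (`(1 − [w])·X`), `rd` (`Z_r − [w]·X′`), `sd`
(`Z_s − [w]·X′`), `rsd` (`(1 − [w])·X′`).  Ingredients: the outside conditions with or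
without the clause «`x ∉ L`» agree (`L` is isolated in `G − F`), the `W`-link of the outside
vanishes at an outside point (`not_conn_compl_rs_of_sepN`), and the join simplifies in each
class.  Own work; std axioms.
-/

namespace Summit.Ventures.PercRepro2

namespace NoPocket

open Finset Classical OneColourSwitch SideSwitch

variable {V : Type*} {E : Type*} {ends : E → Sym2 V} {p q r s d : V} {L : Set V}

section Inner

variable [Fintype V] [DecidableEq V] [Fintype E] [DecidableEq E]

variable (hL : ∀ e x y, ends e = s(x, y) → x ∈ L → y ∈ L ∨ y = r ∨ y = s ∨ y = d)
  (hr : r ∉ L) (hs : s ∉ L) (hd : d ∉ L) (hdr : d ≠ r) (hds : d ≠ s)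
  (hsepN : ¬ Conn (endsD (fun e : {e // e ∉ within ends (L ∪ {r, s, d} : Set V)} => ends e.1) d) (chi (endsD (fun e : {e // e ∉ within ends (L ∪ {r, s, d} : Set V)} => ends e.1) d)
    ({x : V | ∀ e : {e // e ∉ within ends (L ∪ {r, s, d} : Set V)}, (fun e : {e // e ∉ within ends (L ∪ {r, s, d} : Set V)} => ends e.1) e ≠ s(d, x)} ∪ {r, s})) r s)

omit [Fintype V] [DecidableEq V] [Fintype E] [DecidableEq E] in
include hL in
/-- A restricted path (any colouring of the edges off `F`) from a vertex off `L` never enters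
`L`. -/
lemma notMem_L_of_conn_restrict_rsd' {ω' : {e // e ∉ within ends (L ∪ {r, s, d} : Set V)} → Bool}
    {x y : V} (hx : x ∉ L) (h : Conn (fun e : {e // e ∉ within ends (L ∪ {r, s, d} : Set V)} => ends e.1) ω' x y) : y ∉ L := by
  have key : y ∈ {z | z ∉ L} := by
    refine mem_of_conn_of_closed (S := {z | z ∉ L}) ?_ hx h
    intro a _ b hab
    obtain ⟨_, e, _, hends⟩ := openGraph_adj.1 hab
    exact (notMem_L_of_notMem_within_rsd hL e.2 hends).2
  exact key

omit [Fintype V] [DecidableEq V] [Fintype E] [DecidableEq E] in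
include hL hr hs hd in
/-- A restricted `Y`-path from an exit never enters `L`: the three-exit `Y`-world condition is
vacuous on `L`. -/
lemma not_reach_of_mem_L_rsd {ω' : {e // e ∉ within ends (L ∪ {r, s, d} : Set V)} → Bool}
    {x : V} (hx : x ∈ L) :
    ¬ (Conn (fun e : {e // e ∉ within ends (L ∪ {r, s, d} : Set V)} => ends e.1) ω' r x ∨ Conn (fun e : {e // e ∉ within ends (L ∪ {r, s, d} : Set V)} => ends e.1) ω' s x ∨ Conn (fun e : {e // e ∉ within ends (L ∪ {r, s, d} : Set V)} => ends e.1) ω' d x) := by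
  rintro (h | h | h)
  · exact notMem_L_of_conn_restrict_rsd' hL hr h hx
  · exact notMem_L_of_conn_restrict_rsd' hL hs h hx
  · exact notMem_L_of_conn_restrict_rsd' hL hd h hx

omit [Fintype V] [DecidableEq V] [Fintype E] [DecidableEq E] in
include hL hr hs hd in
/-- The outside conditions with the clause «`x ∉ L`» are the outside conditions. -/
lemma outside_iff_rsd {ω' : {e // e ∉ within ends (L ∪ {r, s, d} : Set V)} → Bool} :
    (sep2 (fun e : {e // e ∉ within ends (L ∪ {r, s, d} : Set V)} => ends e.1) p q r s ω' ∧
          ¬ Conn (fun e : {e // e ∉ within ends (L ∪ {r, s, d} : Set V)} => ends e.1) ω' p d ∧ ¬ Conn (fun e : {e // e ∉ within ends (L ∪ {r, s, d} : Set V)} => ends e.1) ω' q d ∧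
          (∀ x, x ∉ L → x ≠ r → x ≠ s → x ≠ d →
            (Conn (fun e : {e // e ∉ within ends (L ∪ {r, s, d} : Set V)} => ends e.1) ω' r x ∨ Conn (fun e : {e // e ∉ within ends (L ∪ {r, s, d} : Set V)} => ends e.1) ω' s x ∨ Conn (fun e : {e // e ∉ within ends (L ∪ {r, s, d} : Set V)} => ends e.1) ω' d x) →
            x ∉ M2 (fun e : {e // e ∉ within ends (L ∪ {r, s, d} : Set V)} => ends e.1) r s ω') ∧
          d ∉ M2 (fun e : {e // e ∉ within ends (L ∪ {r, s, d} : Set V)} => ends e.1) r s ω') ↔ (sep2 (fun e : {e // e ∉ within ends (L ∪ {r, s, d} : Set V)} => ends e.1) p q r s ω' ∧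
          ¬ Conn (fun e : {e // e ∉ within ends (L ∪ {r, s, d} : Set V)} => ends e.1) ω' p d ∧ ¬ Conn (fun e : {e // e ∉ within ends (L ∪ {r, s, d} : Set V)} => ends e.1) ω' q d ∧
          (∀ x, x ≠ r → x ≠ s → x ≠ d →
            (Conn (fun e : {e // e ∉ within ends (L ∪ {r, s, d} : Set V)} => ends e.1) ω' r x ∨ Conn (fun e : {e // e ∉ within ends (L ∪ {r, s, d} : Set V)} => ends e.1) ω' s x ∨ Conn (fun e : {e // e ∉ within ends (L ∪ {r, s, d} : Set V)} => ends e.1) ω' d x) →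
            x ∉ M2 (fun e : {e // e ∉ within ends (L ∪ {r, s, d} : Set V)} => ends e.1) r s ω') ∧
          d ∉ M2 (fun e : {e // e ∉ within ends (L ∪ {r, s, d} : Set V)} => ends e.1) r s ω') := by
  constructor
  · rintro ⟨h1, h2, h3, h4, h5⟩
    refine ⟨h1, h2, h3, fun x hxr hxs hxd hx => ?_, h5⟩
    by_cases hxL : x ∈ L
    · exact (not_reach_of_mem_L_rsd hL hr hs hd hxL hx).elim
    · exact h4 x hxL hxr hxs hxd hx
  · rintro ⟨h1, h2, h3, h4, h5⟩
    exact ⟨h1, h2, h3, fun x _ hxr hxs hxd hx => h4 x hxr hxs hxd hx, h5⟩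

omit [Fintype V] [DecidableEq V] [Fintype E] [DecidableEq E] in
include hL hr hs hd in
/-- The outside defect with the clause «`x ∉ L`» is the outside defect. -/
lemma defect_iff_rsd {ω' : {e // e ∉ within ends (L ∪ {r, s, d} : Set V)} → Bool} :
    (Conn (fun e : {e // e ∉ within ends (L ∪ {r, s, d} : Set V)} => ends e.1) (OneColourSwitch.compl ω') d p ∨
          Conn (fun e : {e // e ∉ within ends (L ∪ {r, s, d} : Set V)} => ends e.1) (OneColourSwitch.compl ω') d q ∨
          ∃ x, x ≠ r ∧ x ≠ s ∧ x ≠ d ∧ x ∉ L ∧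
            (Conn (fun e : {e // e ∉ within ends (L ∪ {r, s, d} : Set V)} => ends e.1) ω' r x ∨ Conn (fun e : {e // e ∉ within ends (L ∪ {r, s, d} : Set V)} => ends e.1) ω' s x ∨ Conn (fun e : {e // e ∉ within ends (L ∪ {r, s, d} : Set V)} => ends e.1) ω' d x) ∧
            Conn (fun e : {e // e ∉ within ends (L ∪ {r, s, d} : Set V)} => ends e.1) (OneColourSwitch.compl ω') d x) ↔ (Conn (fun e : {e // e ∉ within ends (L ∪ {r, s, d} : Set V)} => ends e.1) (OneColourSwitch.compl ω') d p ∨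
          Conn (fun e : {e // e ∉ within ends (L ∪ {r, s, d} : Set V)} => ends e.1) (OneColourSwitch.compl ω') d q ∨
          ∃ x, x ≠ r ∧ x ≠ s ∧ x ≠ d ∧
            (Conn (fun e : {e // e ∉ within ends (L ∪ {r, s, d} : Set V)} => ends e.1) ω' r x ∨ Conn (fun e : {e // e ∉ within ends (L ∪ {r, s, d} : Set V)} => ends e.1) ω' s x ∨ Conn (fun e : {e // e ∉ within ends (L ∪ {r, s, d} : Set V)} => ends e.1) ω' d x) ∧
            Conn (fun e : {e // e ∉ within ends (L ∪ {r, s, d} : Set V)} => ends e.1) (OneColourSwitch.compl ω') d x) := by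
  constructor
  · rintro (h | h | ⟨x, h1, h2, h3, _, h4, h5⟩)
    · exact Or.inl h
    · exact Or.inr (Or.inl h)
    · exact Or.inr (Or.inr ⟨x, h1, h2, h3, h4, h5⟩)
  · rintro (h | h | ⟨x, h1, h2, h3, h4, h5⟩)
    · exact Or.inl h
    · exact Or.inr (Or.inl h)
    · refine Or.inr (Or.inr ⟨x, h1, h2, h3, ?_, h4, h5⟩)
      intro hxL
      exact not_reach_of_mem_L_rsd hL hr hs hd hxL h4

omit [Fintype V] [DecidableEq V] [Fintype E] [DecidableEq E] in
include hdr hds hsepN in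
/-- At an outside point the outside `W`-link vanishes (packaged for the class lemmas). -/
lemma inner_summand_rsd {ω' : {e // e ∉ within ends (L ∪ {r, s, d} : Set V)} → Bool}
    (hΩ : (sep2 (fun e : {e // e ∉ within ends (L ∪ {r, s, d} : Set V)} => ends e.1) p q r s ω' ∧
          ¬ Conn (fun e : {e // e ∉ within ends (L ∪ {r, s, d} : Set V)} => ends e.1) ω' p d ∧ ¬ Conn (fun e : {e // e ∉ within ends (L ∪ {r, s, d} : Set V)} => ends e.1) ω' q d ∧
          (∀ x, x ≠ r → x ≠ s → x ≠ d →
            (Conn (fun e : {e // e ∉ within ends (L ∪ {r, s, d} : Set V)} => ends e.1) ω' r x ∨ Conn (fun e : {e // e ∉ within ends (L ∪ {r, s, d} : Set V)} => ends e.1) ω' s x ∨ Conn (fun e : {e // e ∉ within ends (L ∪ {r, s, d} : Set V)} => ends e.1) ω' d x) →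
            x ∉ M2 (fun e : {e // e ∉ within ends (L ∪ {r, s, d} : Set V)} => ends e.1) r s ω') ∧
          d ∉ M2 (fun e : {e // e ∉ within ends (L ∪ {r, s, d} : Set V)} => ends e.1) r s ω')) :
    ¬ Conn (fun e : {e // e ∉ within ends (L ∪ {r, s, d} : Set V)} => ends e.1) (OneColourSwitch.compl ω') r s :=
  not_conn_compl_rs_of_sepN hdr hds hsepN hΩ.2.2.2.2 hΩ.2.2.2.1

include hL hr hs hd hdr hds hsepN in
/-- **Class `∅`** (no `Y_F`-link among the exits): the inner sum is `Y − [w]·X`. -/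
lemma inner_eq_cls_empty_rsd
    {τ : {e // ¬ (e ∉ within ends (L ∪ {r, s, d} : Set V))} → Bool}
    (hA : (d ∉ M2 (fun e : {e // ¬ (e ∉ within ends (L ∪ {r, s, d} : Set V))} => ends e.1) r s τ ∧
          ∀ x ∈ L,
            (Conn (fun e : {e // ¬ (e ∉ within ends (L ∪ {r, s, d} : Set V))} => ends e.1) τ r x ∨ Conn (fun e : {e // ¬ (e ∉ within ends (L ∪ {r, s, d} : Set V))} => ends e.1) τ s x ∨ Conn (fun e : {e // ¬ (e ∉ within ends (L ∪ {r, s, d} : Set V))} => ends e.1) τ d x) →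
            x ∉ M2 (fun e : {e // ¬ (e ∉ within ends (L ∪ {r, s, d} : Set V))} => ends e.1) r s τ)) (h1' : ¬ Conn (fun e : {e // ¬ (e ∉ within ends (L ∪ {r, s, d} : Set V))} => ends e.1) τ r s) (h2' : ¬ Conn (fun e : {e // ¬ (e ∉ within ends (L ∪ {r, s, d} : Set V))} => ends e.1) τ r d) (h3 : ¬ Conn (fun e : {e // ¬ (e ∉ within ends (L ∪ {r, s, d} : Set V))} => ends e.1) τ d s) :
    (∑ ω' : ({e // e ∉ within ends (L ∪ {r, s, d} : Set V)} → Bool),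
      if ((sep2 (fun e : {e // e ∉ within ends (L ∪ {r, s, d} : Set V)} => ends e.1) p q r s ω' ∧
          ¬ Conn (fun e : {e // e ∉ within ends (L ∪ {r, s, d} : Set V)} => ends e.1) ω' p d ∧ ¬ Conn (fun e : {e // e ∉ within ends (L ∪ {r, s, d} : Set V)} => ends e.1) ω' q d ∧
          (∀ x, x ∉ L → x ≠ r → x ≠ s → x ≠ d →
            (Conn (fun e : {e // e ∉ within ends (L ∪ {r, s, d} : Set V)} => ends e.1) ω' r x ∨ Conn (fun e : {e // e ∉ within ends (L ∪ {r, s, d} : Set V)} => ends e.1) ω' s x ∨ Conn (fun e : {e // e ∉ within ends (L ∪ {r, s, d} : Set V)} => ends e.1) ω' d x) →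
            x ∉ M2 (fun e : {e // e ∉ within ends (L ∪ {r, s, d} : Set V)} => ends e.1) r s ω') ∧
          d ∉ M2 (fun e : {e // e ∉ within ends (L ∪ {r, s, d} : Set V)} => ends e.1) r s ω') ∧ (d ∉ M2 (fun e : {e // ¬ (e ∉ within ends (L ∪ {r, s, d} : Set V))} => ends e.1) r s τ ∧
          ∀ x ∈ L,
            (Conn (fun e : {e // ¬ (e ∉ within ends (L ∪ {r, s, d} : Set V))} => ends e.1) τ r x ∨ Conn (fun e : {e // ¬ (e ∉ within ends (L ∪ {r, s, d} : Set V))} => ends e.1) τ s x ∨ Conn (fun e : {e // ¬ (e ∉ within ends (L ∪ {r, s, d} : Set V))} => ends e.1) τ d x) →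
            x ∉ M2 (fun e : {e // ¬ (e ∉ within ends (L ∪ {r, s, d} : Set V))} => ends e.1) r s τ) ∧ (d ∈ K2 (fun e : {e // e ∉ within ends (L ∪ {r, s, d} : Set V)} => ends e.1) r s ω' ∨ d ∈ K2 (fun e : {e // ¬ (e ∉ within ends (L ∪ {r, s, d} : Set V))} => ends e.1) r s τ)) ∧ ((Conn (fun e : {e // e ∉ within ends (L ∪ {r, s, d} : Set V)} => ends e.1) (OneColourSwitch.compl ω') d p ∨
          Conn (fun e : {e // e ∉ within ends (L ∪ {r, s, d} : Set V)} => ends e.1) (OneColourSwitch.compl ω') d q ∨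
          ∃ x, x ≠ r ∧ x ≠ s ∧ x ≠ d ∧ x ∉ L ∧
            (Conn (fun e : {e // e ∉ within ends (L ∪ {r, s, d} : Set V)} => ends e.1) ω' r x ∨ Conn (fun e : {e // e ∉ within ends (L ∪ {r, s, d} : Set V)} => ends e.1) ω' s x ∨ Conn (fun e : {e // e ∉ within ends (L ∪ {r, s, d} : Set V)} => ends e.1) ω' d x) ∧
            Conn (fun e : {e // e ∉ within ends (L ∪ {r, s, d} : Set V)} => ends e.1) (OneColourSwitch.compl ω') d x) ∨ (∃ x ∈ L,
          (Conn (fun e : {e // ¬ (e ∉ within ends (L ∪ {r, s, d} : Set V))} => ends e.1) τ r x ∨ Conn (fun e : {e // ¬ (e ∉ within ends (L ∪ {r, s, d} : Set V))} => ends e.1) τ s x ∨ Conn (fun e : {e // ¬ (e ∉ within ends (L ∪ {r, s, d} : Set V))} => ends e.1) τ d x) ∧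
          Conn (fun e : {e // ¬ (e ∉ within ends (L ∪ {r, s, d} : Set V))} => ends e.1) (OneColourSwitch.compl τ) d x)) then
        sigma (fun e : {e // e ∉ within ends (L ∪ {r, s, d} : Set V)} => ends e.1) ω' p q * ((if ((Conn (fun e : {e // e ∉ within ends (L ∪ {r, s, d} : Set V)} => ends e.1) ω' r s ∨ Conn (fun e : {e // ¬ (e ∉ within ends (L ∪ {r, s, d} : Set V))} => ends e.1) τ r s) ∨
            ((Conn (fun e : {e // e ∉ within ends (L ∪ {r, s, d} : Set V)} => ends e.1) ω' r d ∨ Conn (fun e : {e // ¬ (e ∉ within ends (L ∪ {r, s, d} : Set V))} => ends e.1) τ r d) ∧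
             (Conn (fun e : {e // e ∉ within ends (L ∪ {r, s, d} : Set V)} => ends e.1) ω' d s ∨ Conn (fun e : {e // ¬ (e ∉ within ends (L ∪ {r, s, d} : Set V))} => ends e.1) τ d s))) then (1 : ℤ) else 0) - (if (Conn (fun e : {e // e ∉ within ends (L ∪ {r, s, d} : Set V)} => ends e.1) (OneColourSwitch.compl ω') r s ∨ Conn (fun e : {e // ¬ (e ∉ within ends (L ∪ {r, s, d} : Set V))} => ends e.1) (OneColourSwitch.compl τ) r s) then (1 : ℤ) else 0))
      else 0) = (∑ ω' : ({e // e ∉ within ends (L ∪ {r, s, d} : Set V)} → Bool),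
      if (sep2 (fun e : {e // e ∉ within ends (L ∪ {r, s, d} : Set V)} => ends e.1) p q r s ω' ∧
          ¬ Conn (fun e : {e // e ∉ within ends (L ∪ {r, s, d} : Set V)} => ends e.1) ω' p d ∧ ¬ Conn (fun e : {e // e ∉ within ends (L ∪ {r, s, d} : Set V)} => ends e.1) ω' q d ∧
          (∀ x, x ≠ r → x ≠ s → x ≠ d →
            (Conn (fun e : {e // e ∉ within ends (L ∪ {r, s, d} : Set V)} => ends e.1) ω' r x ∨ Conn (fun e : {e // e ∉ within ends (L ∪ {r, s, d} : Set V)} => ends e.1) ω' s x ∨ Conn (fun e : {e // e ∉ within ends (L ∪ {r, s, d} : Set V)} => ends e.1) ω' d x) →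
            x ∉ M2 (fun e : {e // e ∉ within ends (L ∪ {r, s, d} : Set V)} => ends e.1) r s ω') ∧
          d ∉ M2 (fun e : {e // e ∉ within ends (L ∪ {r, s, d} : Set V)} => ends e.1) r s ω') ∧ (Conn (fun e : {e // e ∉ within ends (L ∪ {r, s, d} : Set V)} => ends e.1) ω' r d ∨ Conn (fun e : {e // e ∉ within ends (L ∪ {r, s, d} : Set V)} => ends e.1) ω' s d) ∧ ((Conn (fun e : {e // e ∉ within ends (L ∪ {r, s, d} : Set V)} => ends e.1) (OneColourSwitch.compl ω') d p ∨
          Conn (fun e : {e // e ∉ within ends (L ∪ {r, s, d} : Set V)} => ends e.1) (OneColourSwitch.compl ω') d q ∨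
          ∃ x, x ≠ r ∧ x ≠ s ∧ x ≠ d ∧
            (Conn (fun e : {e // e ∉ within ends (L ∪ {r, s, d} : Set V)} => ends e.1) ω' r x ∨ Conn (fun e : {e // e ∉ within ends (L ∪ {r, s, d} : Set V)} => ends e.1) ω' s x ∨ Conn (fun e : {e // e ∉ within ends (L ∪ {r, s, d} : Set V)} => ends e.1) ω' d x) ∧
            Conn (fun e : {e // e ∉ within ends (L ∪ {r, s, d} : Set V)} => ends e.1) (OneColourSwitch.compl ω') d x) ∨ (∃ x ∈ L,
          (Conn (fun e : {e // ¬ (e ∉ within ends (L ∪ {r, s, d} : Set V))} => ends e.1) τ r x ∨ Conn (fun e : {e // ¬ (e ∉ within ends (L ∪ {r, s, d} : Set V))} => ends e.1) τ s x ∨ Conn (fun e : {e // ¬ (e ∉ within ends (L ∪ {r, s, d} : Set V))} => ends e.1) τ d x) ∧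
          Conn (fun e : {e // ¬ (e ∉ within ends (L ∪ {r, s, d} : Set V))} => ends e.1) (OneColourSwitch.compl τ) d x)) then sigma (fun e : {e // e ∉ within ends (L ∪ {r, s, d} : Set V)} => ends e.1) ω' p q * (if Conn (fun e : {e // e ∉ within ends (L ∪ {r, s, d} : Set V)} => ends e.1) ω' r s then (1 : ℤ) else 0) else 0) - (if Conn (fun e : {e // ¬ (e ∉ within ends (L ∪ {r, s, d} : Set V))} => ends e.1) (OneColourSwitch.compl τ) r s then (1 : ℤ) else 0) * (∑ ω' : ({e // e ∉ within ends (L ∪ {r, s, d} : Set V)} → Bool),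
      if (sep2 (fun e : {e // e ∉ within ends (L ∪ {r, s, d} : Set V)} => ends e.1) p q r s ω' ∧
          ¬ Conn (fun e : {e // e ∉ within ends (L ∪ {r, s, d} : Set V)} => ends e.1) ω' p d ∧ ¬ Conn (fun e : {e // e ∉ within ends (L ∪ {r, s, d} : Set V)} => ends e.1) ω' q d ∧
          (∀ x, x ≠ r → x ≠ s → x ≠ d →
            (Conn (fun e : {e // e ∉ within ends (L ∪ {r, s, d} : Set V)} => ends e.1) ω' r x ∨ Conn (fun e : {e // e ∉ within ends (L ∪ {r, s, d} : Set V)} => ends e.1) ω' s x ∨ Conn (fun e : {e // e ∉ within ends (L ∪ {r, s, d} : Set V)} => ends e.1) ω' d x) →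
            x ∉ M2 (fun e : {e // e ∉ within ends (L ∪ {r, s, d} : Set V)} => ends e.1) r s ω') ∧
          d ∉ M2 (fun e : {e // e ∉ within ends (L ∪ {r, s, d} : Set V)} => ends e.1) r s ω') ∧ (Conn (fun e : {e // e ∉ within ends (L ∪ {r, s, d} : Set V)} => ends e.1) ω' r d ∨ Conn (fun e : {e // e ∉ within ends (L ∪ {r, s, d} : Set V)} => ends e.1) ω' s d) ∧ ((Conn (fun e : {e // e ∉ within ends (L ∪ {r, s, d} : Set V)} => ends e.1) (OneColourSwitch.compl ω') d p ∨
          Conn (fun e : {e // e ∉ within ends (L ∪ {r, s, d} : Set V)} => ends e.1) (OneColourSwitch.compl ω') d q ∨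
          ∃ x, x ≠ r ∧ x ≠ s ∧ x ≠ d ∧
            (Conn (fun e : {e // e ∉ within ends (L ∪ {r, s, d} : Set V)} => ends e.1) ω' r x ∨ Conn (fun e : {e // e ∉ within ends (L ∪ {r, s, d} : Set V)} => ends e.1) ω' s x ∨ Conn (fun e : {e // e ∉ within ends (L ∪ {r, s, d} : Set V)} => ends e.1) ω' d x) ∧
            Conn (fun e : {e // e ∉ within ends (L ∪ {r, s, d} : Set V)} => ends e.1) (OneColourSwitch.compl ω') d x) ∨ (∃ x ∈ L,
          (Conn (fun e : {e // ¬ (e ∉ within ends (L ∪ {r, s, d} : Set V))} => ends e.1) τ r x ∨ Conn (fun e : {e // ¬ (e ∉ within ends (L ∪ {r, s, d} : Set V))} => ends e.1) τ s x ∨ Conn (fun e : {e // ¬ (e ∉ within ends (L ∪ {r, s, d} : Set V))} => ends e.1) τ d x) ∧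
          Conn (fun e : {e // ¬ (e ∉ within ends (L ∪ {r, s, d} : Set V))} => ends e.1) (OneColourSwitch.compl τ) d x)) then sigma (fun e : {e // e ∉ within ends (L ∪ {r, s, d} : Set V)} => ends e.1) ω' p q else 0) := by
  have hKF : d ∉ K2 (fun e : {e // ¬ (e ∉ within ends (L ∪ {r, s, d} : Set V))} => ends e.1) r s τ := by
    rw [mem_K2_iff]
    rintro (h | h)
    · exact h2' h
    · exact h3 (conn_symm h)
  rw [Finset.mul_sum, ← Finset.sum_sub_distrib]
  refine Finset.sum_congr rfl fun ω' _ => ?_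
  by_cases hΩ : (sep2 (fun e : {e // e ∉ within ends (L ∪ {r, s, d} : Set V)} => ends e.1) p q r s ω' ∧
            ¬ Conn (fun e : {e // e ∉ within ends (L ∪ {r, s, d} : Set V)} => ends e.1) ω' p d ∧ ¬ Conn (fun e : {e // e ∉ within ends (L ∪ {r, s, d} : Set V)} => ends e.1) ω' q d ∧
            (∀ x, x ≠ r → x ≠ s → x ≠ d →
              (Conn (fun e : {e // e ∉ within ends (L ∪ {r, s, d} : Set V)} => ends e.1) ω' r x ∨ Conn (fun e : {e // e ∉ within ends (L ∪ {r, s, d} : Set V)} => ends e.1) ω' s x ∨ Conn (fun e : {e // e ∉ within ends (L ∪ {r, s, d} : Set V)} => ends e.1) ω' d x) →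
              x ∉ M2 (fun e : {e // e ∉ within ends (L ∪ {r, s, d} : Set V)} => ends e.1) r s ω') ∧
            d ∉ M2 (fun e : {e // e ∉ within ends (L ∪ {r, s, d} : Set V)} => ends e.1) r s ω')
  · have hΩL := (outside_iff_rsd hL hr hs hd).2 hΩ
    have hW' := inner_summand_rsd hdr hds hsepN hΩ
    have hdef := defect_iff_rsd (p := p) (q := q) (ω' := ω') hL hr hs hd
    have hdsrc : (d ∈ K2 (fun e : {e // e ∉ within ends (L ∪ {r, s, d} : Set V)} => ends e.1) r s ω' ∨ d ∈ K2 (fun e : {e // ¬ (e ∉ within ends (L ∪ {r, s, d} : Set V))} => ends e.1) r s τ) ↔ (Conn (fun e : {e // e ∉ within ends (L ∪ {r, s, d} : Set V)} => ends e.1) ω' r d ∨ Conn (fun e : {e // e ∉ within ends (L ∪ {r, s, d} : Set V)} => ends e.1) ω' s d) := by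
      rw [mem_K2_iff]
      constructor
      · rintro (h | h)
        · exact h
        · exact (hKF h).elim
      · exact fun h => Or.inl h
    by_cases hc : ((Conn (fun e : {e // e ∉ within ends (L ∪ {r, s, d} : Set V)} => ends e.1) ω' r d ∨ Conn (fun e : {e // e ∉ within ends (L ∪ {r, s, d} : Set V)} => ends e.1) ω' s d) ∧ ((Conn (fun e : {e // e ∉ within ends (L ∪ {r, s, d} : Set V)} => ends e.1) (OneColourSwitch.compl ω') d p ∨
              Conn (fun e : {e // e ∉ within ends (L ∪ {r, s, d} : Set V)} => ends e.1) (OneColourSwitch.compl ω') d q ∨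
              ∃ x, x ≠ r ∧ x ≠ s ∧ x ≠ d ∧
                (Conn (fun e : {e // e ∉ within ends (L ∪ {r, s, d} : Set V)} => ends e.1) ω' r x ∨ Conn (fun e : {e // e ∉ within ends (L ∪ {r, s, d} : Set V)} => ends e.1) ω' s x ∨ Conn (fun e : {e // e ∉ within ends (L ∪ {r, s, d} : Set V)} => ends e.1) ω' d x) ∧
                Conn (fun e : {e // e ∉ within ends (L ∪ {r, s, d} : Set V)} => ends e.1) (OneColourSwitch.compl ω') d x) ∨ (∃ x ∈ L,
              (Conn (fun e : {e // ¬ (e ∉ within ends (L ∪ {r, s, d} : Set V))} => ends e.1) τ r x ∨ Conn (fun e : {e // ¬ (e ∉ within ends (L ∪ {r, s, d} : Set V))} => ends e.1) τ s x ∨ Conn (fun e : {e // ¬ (e ∉ within ends (L ∪ {r, s, d} : Set V))} => ends e.1) τ d x) ∧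
              Conn (fun e : {e // ¬ (e ∉ within ends (L ∪ {r, s, d} : Set V))} => ends e.1) (OneColourSwitch.compl τ) d x)))
    · have hLc : ((sep2 (fun e : {e // e ∉ within ends (L ∪ {r, s, d} : Set V)} => ends e.1) p q r s ω' ∧
              ¬ Conn (fun e : {e // e ∉ within ends (L ∪ {r, s, d} : Set V)} => ends e.1) ω' p d ∧ ¬ Conn (fun e : {e // e ∉ within ends (L ∪ {r, s, d} : Set V)} => ends e.1) ω' q d ∧
              (∀ x, x ∉ L → x ≠ r → x ≠ s → x ≠ d →
                (Conn (fun e : {e // e ∉ within ends (L ∪ {r, s, d} : Set V)} => ends e.1) ω' r x ∨ Conn (fun e : {e // e ∉ within ends (L ∪ {r, s, d} : Set V)} => ends e.1) ω' s x ∨ Conn (fun e : {e // e ∉ within ends (L ∪ {r, s, d} : Set V)} => ends e.1) ω' d x) →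
                x ∉ M2 (fun e : {e // e ∉ within ends (L ∪ {r, s, d} : Set V)} => ends e.1) r s ω') ∧
              d ∉ M2 (fun e : {e // e ∉ within ends (L ∪ {r, s, d} : Set V)} => ends e.1) r s ω') ∧ (d ∉ M2 (fun e : {e // ¬ (e ∉ within ends (L ∪ {r, s, d} : Set V))} => ends e.1) r s τ ∧
              ∀ x ∈ L,
                (Conn (fun e : {e // ¬ (e ∉ within ends (L ∪ {r, s, d} : Set V))} => ends e.1) τ r x ∨ Conn (fun e : {e // ¬ (e ∉ within ends (L ∪ {r, s, d} : Set V))} => ends e.1) τ s x ∨ Conn (fun e : {e // ¬ (e ∉ within ends (L ∪ {r, s, d} : Set V))} => ends e.1) τ d x) →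
                x ∉ M2 (fun e : {e // ¬ (e ∉ within ends (L ∪ {r, s, d} : Set V))} => ends e.1) r s τ) ∧ (d ∈ K2 (fun e : {e // e ∉ within ends (L ∪ {r, s, d} : Set V)} => ends e.1) r s ω' ∨ d ∈ K2 (fun e : {e // ¬ (e ∉ within ends (L ∪ {r, s, d} : Set V))} => ends e.1) r s τ)) ∧ ((Conn (fun e : {e // e ∉ within ends (L ∪ {r, s, d} : Set V)} => ends e.1) (OneColourSwitch.compl ω') d p ∨
              Conn (fun e : {e // e ∉ within ends (L ∪ {r, s, d} : Set V)} => ends e.1) (OneColourSwitch.compl ω') d q ∨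
              ∃ x, x ≠ r ∧ x ≠ s ∧ x ≠ d ∧ x ∉ L ∧
                (Conn (fun e : {e // e ∉ within ends (L ∪ {r, s, d} : Set V)} => ends e.1) ω' r x ∨ Conn (fun e : {e // e ∉ within ends (L ∪ {r, s, d} : Set V)} => ends e.1) ω' s x ∨ Conn (fun e : {e // e ∉ within ends (L ∪ {r, s, d} : Set V)} => ends e.1) ω' d x) ∧
                Conn (fun e : {e // e ∉ within ends (L ∪ {r, s, d} : Set V)} => ends e.1) (OneColourSwitch.compl ω') d x) ∨ (∃ x ∈ L,
              (Conn (fun e : {e // ¬ (e ∉ within ends (L ∪ {r, s, d} : Set V))} => ends e.1) τ r x ∨ Conn (fun e : {e // ¬ (e ∉ within ends (L ∪ {r, s, d} : Set V))} => ends e.1) τ s x ∨ Conn (fun e : {e // ¬ (e ∉ within ends (L ∪ {r, s, d} : Set V))} => ends e.1) τ d x) ∧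
              Conn (fun e : {e // ¬ (e ∉ within ends (L ∪ {r, s, d} : Set V))} => ends e.1) (OneColourSwitch.compl τ) d x)) := ⟨⟨hΩL, hA, hdsrc.2 hc.1⟩, (or_congr_left hdef).2 hc.2⟩
      have hRc : (sep2 (fun e : {e // e ∉ within ends (L ∪ {r, s, d} : Set V)} => ends e.1) p q r s ω' ∧
                ¬ Conn (fun e : {e // e ∉ within ends (L ∪ {r, s, d} : Set V)} => ends e.1) ω' p d ∧ ¬ Conn (fun e : {e // e ∉ within ends (L ∪ {r, s, d} : Set V)} => ends e.1) ω' q d ∧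
                (∀ x, x ≠ r → x ≠ s → x ≠ d →
                  (Conn (fun e : {e // e ∉ within ends (L ∪ {r, s, d} : Set V)} => ends e.1) ω' r x ∨ Conn (fun e : {e // e ∉ within ends (L ∪ {r, s, d} : Set V)} => ends e.1) ω' s x ∨ Conn (fun e : {e // e ∉ within ends (L ∪ {r, s, d} : Set V)} => ends e.1) ω' d x) →
                  x ∉ M2 (fun e : {e // e ∉ within ends (L ∪ {r, s, d} : Set V)} => ends e.1) r s ω') ∧
                d ∉ M2 (fun e : {e // e ∉ within ends (L ∪ {r, s, d} : Set V)} => ends e.1) r s ω') ∧ (Conn (fun e : {e // e ∉ within ends (L ∪ {r, s, d} : Set V)} => ends e.1) ω' r d ∨ Conn (fun e : {e // e ∉ within ends (L ∪ {r, s, d} : Set V)} => ends e.1) ω' s d) ∧ ((Conn (fun e : {e // e ∉ within ends (L ∪ {r, s, d} : Set V)} => ends e.1) (OneColourSwitch.compl ω') d p ∨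
                Conn (fun e : {e // e ∉ within ends (L ∪ {r, s, d} : Set V)} => ends e.1) (OneColourSwitch.compl ω') d q ∨
                ∃ x, x ≠ r ∧ x ≠ s ∧ x ≠ d ∧
                  (Conn (fun e : {e // e ∉ within ends (L ∪ {r, s, d} : Set V)} => ends e.1) ω' r x ∨ Conn (fun e : {e // e ∉ within ends (L ∪ {r, s, d} : Set V)} => ends e.1) ω' s x ∨ Conn (fun e : {e // e ∉ within ends (L ∪ {r, s, d} : Set V)} => ends e.1) ω' d x) ∧
                  Conn (fun e : {e // e ∉ within ends (L ∪ {r, s, d} : Set V)} => ends e.1) (OneColourSwitch.compl ω') d x) ∨ (∃ x ∈ L,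
                (Conn (fun e : {e // ¬ (e ∉ within ends (L ∪ {r, s, d} : Set V))} => ends e.1) τ r x ∨ Conn (fun e : {e // ¬ (e ∉ within ends (L ∪ {r, s, d} : Set V))} => ends e.1) τ s x ∨ Conn (fun e : {e // ¬ (e ∉ within ends (L ∪ {r, s, d} : Set V))} => ends e.1) τ d x) ∧
                Conn (fun e : {e // ¬ (e ∉ within ends (L ∪ {r, s, d} : Set V))} => ends e.1) (OneColourSwitch.compl τ) d x)) := ⟨hΩ, hc.1, hc.2⟩
      rw [if_pos hLc, if_pos hRc, if_pos hRc]
      have hJ : ((Conn (fun e : {e // e ∉ within ends (L ∪ {r, s, d} : Set V)} => ends e.1) ω' r s ∨ Conn (fun e : {e // ¬ (e ∉ within ends (L ∪ {r, s, d} : Set V))} => ends e.1) τ r s) ∨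
                  ((Conn (fun e : {e // e ∉ within ends (L ∪ {r, s, d} : Set V)} => ends e.1) ω' r d ∨ Conn (fun e : {e // ¬ (e ∉ within ends (L ∪ {r, s, d} : Set V))} => ends e.1) τ r d) ∧
                   (Conn (fun e : {e // e ∉ within ends (L ∪ {r, s, d} : Set V)} => ends e.1) ω' d s ∨ Conn (fun e : {e // ¬ (e ∉ within ends (L ∪ {r, s, d} : Set V))} => ends e.1) τ d s))) ↔ Conn (fun e : {e // e ∉ within ends (L ∪ {r, s, d} : Set V)} => ends e.1) ω' r s := by
        constructor
        · rintro ((h | h) | ⟨h1, h2⟩)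
          · exact h
          · exact (h1' h).elim
          · rcases h1 with h1 | h1
            · rcases h2 with h2 | h2
              · exact conn_trans h1 h2
              · exact (h3 h2).elim
            · exact (h2' h1).elim
        · exact fun h => Or.inl (Or.inl h)
      have hWL : (Conn (fun e : {e // e ∉ within ends (L ∪ {r, s, d} : Set V)} => ends e.1) (OneColourSwitch.compl ω') r s ∨ Conn (fun e : {e // ¬ (e ∉ within ends (L ∪ {r, s, d} : Set V))} => ends e.1) (OneColourSwitch.compl τ) r s) ↔ Conn (fun e : {e // ¬ (e ∉ within ends (L ∪ {r, s, d} : Set V))} => ends e.1) (OneColourSwitch.compl τ) r s :=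
        ⟨fun h => by rcases h with h | h; exact (hW' h).elim; exact h, fun h => Or.inr h⟩
      by_cases hj : Conn (fun e : {e // e ∉ within ends (L ∪ {r, s, d} : Set V)} => ends e.1) ω' r s
      · have hJ' : ((Conn (fun e : {e // e ∉ within ends (L ∪ {r, s, d} : Set V)} => ends e.1) ω' r s ∨ Conn (fun e : {e // ¬ (e ∉ within ends (L ∪ {r, s, d} : Set V))} => ends e.1) τ r s) ∨
                  ((Conn (fun e : {e // e ∉ within ends (L ∪ {r, s, d} : Set V)} => ends e.1) ω' r d ∨ Conn (fun e : {e // ¬ (e ∉ within ends (L ∪ {r, s, d} : Set V))} => ends e.1) τ r d) ∧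
                   (Conn (fun e : {e // e ∉ within ends (L ∪ {r, s, d} : Set V)} => ends e.1) ω' d s ∨ Conn (fun e : {e // ¬ (e ∉ within ends (L ∪ {r, s, d} : Set V))} => ends e.1) τ d s))) := hJ.2 hj
        rw [if_pos hJ', if_pos hj]
        by_cases hw : Conn (fun e : {e // ¬ (e ∉ within ends (L ∪ {r, s, d} : Set V))} => ends e.1) (OneColourSwitch.compl τ) r s
        · rw [if_pos (hWL.2 hw), if_pos hw]; ring
        · rw [if_neg (fun h => hw (hWL.1 h)), if_neg hw]; ring
      · have hJ' : ¬ ((Conn (fun e : {e // e ∉ within ends (L ∪ {r, s, d} : Set V)} => ends e.1) ω' r s ∨ Conn (fun e : {e // ¬ (e ∉ within ends (L ∪ {r, s, d} : Set V))} => ends e.1) τ r s) ∨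
                  ((Conn (fun e : {e // e ∉ within ends (L ∪ {r, s, d} : Set V)} => ends e.1) ω' r d ∨ Conn (fun e : {e // ¬ (e ∉ within ends (L ∪ {r, s, d} : Set V))} => ends e.1) τ r d) ∧
                   (Conn (fun e : {e // e ∉ within ends (L ∪ {r, s, d} : Set V)} => ends e.1) ω' d s ∨ Conn (fun e : {e // ¬ (e ∉ within ends (L ∪ {r, s, d} : Set V))} => ends e.1) τ d s))) := fun h => hj (hJ.1 h)
        rw [if_neg hJ', if_neg hj]
        by_cases hw : Conn (fun e : {e // ¬ (e ∉ within ends (L ∪ {r, s, d} : Set V))} => ends e.1) (OneColourSwitch.compl τ) r s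
        · rw [if_pos (hWL.2 hw), if_pos hw]; ring
        · rw [if_neg (fun h => hw (hWL.1 h)), if_neg hw]; ring
    · have hLn : ¬ (((sep2 (fun e : {e // e ∉ within ends (L ∪ {r, s, d} : Set V)} => ends e.1) p q r s ω' ∧
              ¬ Conn (fun e : {e // e ∉ within ends (L ∪ {r, s, d} : Set V)} => ends e.1) ω' p d ∧ ¬ Conn (fun e : {e // e ∉ within ends (L ∪ {r, s, d} : Set V)} => ends e.1) ω' q d ∧
              (∀ x, x ∉ L → x ≠ r → x ≠ s → x ≠ d →
                (Conn (fun e : {e // e ∉ within ends (L ∪ {r, s, d} : Set V)} => ends e.1) ω' r x ∨ Conn (fun e : {e // e ∉ within ends (L ∪ {r, s, d} : Set V)} => ends e.1) ω' s x ∨ Conn (fun e : {e // e ∉ within ends (L ∪ {r, s, d} : Set V)} => ends e.1) ω' d x) →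
                x ∉ M2 (fun e : {e // e ∉ within ends (L ∪ {r, s, d} : Set V)} => ends e.1) r s ω') ∧
              d ∉ M2 (fun e : {e // e ∉ within ends (L ∪ {r, s, d} : Set V)} => ends e.1) r s ω') ∧ (d ∉ M2 (fun e : {e // ¬ (e ∉ within ends (L ∪ {r, s, d} : Set V))} => ends e.1) r s τ ∧
              ∀ x ∈ L,
                (Conn (fun e : {e // ¬ (e ∉ within ends (L ∪ {r, s, d} : Set V))} => ends e.1) τ r x ∨ Conn (fun e : {e // ¬ (e ∉ within ends (L ∪ {r, s, d} : Set V))} => ends e.1) τ s x ∨ Conn (fun e : {e // ¬ (e ∉ within ends (L ∪ {r, s, d} : Set V))} => ends e.1) τ d x) →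
                x ∉ M2 (fun e : {e // ¬ (e ∉ within ends (L ∪ {r, s, d} : Set V))} => ends e.1) r s τ) ∧ (d ∈ K2 (fun e : {e // e ∉ within ends (L ∪ {r, s, d} : Set V)} => ends e.1) r s ω' ∨ d ∈ K2 (fun e : {e // ¬ (e ∉ within ends (L ∪ {r, s, d} : Set V))} => ends e.1) r s τ)) ∧ ((Conn (fun e : {e // e ∉ within ends (L ∪ {r, s, d} : Set V)} => ends e.1) (OneColourSwitch.compl ω') d p ∨
              Conn (fun e : {e // e ∉ within ends (L ∪ {r, s, d} : Set V)} => ends e.1) (OneColourSwitch.compl ω') d q ∨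
              ∃ x, x ≠ r ∧ x ≠ s ∧ x ≠ d ∧ x ∉ L ∧
                (Conn (fun e : {e // e ∉ within ends (L ∪ {r, s, d} : Set V)} => ends e.1) ω' r x ∨ Conn (fun e : {e // e ∉ within ends (L ∪ {r, s, d} : Set V)} => ends e.1) ω' s x ∨ Conn (fun e : {e // e ∉ within ends (L ∪ {r, s, d} : Set V)} => ends e.1) ω' d x) ∧
                Conn (fun e : {e // e ∉ within ends (L ∪ {r, s, d} : Set V)} => ends e.1) (OneColourSwitch.compl ω') d x) ∨ (∃ x ∈ L,
              (Conn (fun e : {e // ¬ (e ∉ within ends (L ∪ {r, s, d} : Set V))} => ends e.1) τ r x ∨ Conn (fun e : {e // ¬ (e ∉ within ends (L ∪ {r, s, d} : Set V))} => ends e.1) τ s x ∨ Conn (fun e : {e // ¬ (e ∉ within ends (L ∪ {r, s, d} : Set V))} => ends e.1) τ d x) ∧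
              Conn (fun e : {e // ¬ (e ∉ within ends (L ∪ {r, s, d} : Set V))} => ends e.1) (OneColourSwitch.compl τ) d x))) := by
        intro h; exact hc ⟨hdsrc.1 h.1.2.2, (or_congr_left hdef).1 h.2⟩
      have hRn : ¬ ((sep2 (fun e : {e // e ∉ within ends (L ∪ {r, s, d} : Set V)} => ends e.1) p q r s ω' ∧
                ¬ Conn (fun e : {e // e ∉ within ends (L ∪ {r, s, d} : Set V)} => ends e.1) ω' p d ∧ ¬ Conn (fun e : {e // e ∉ within ends (L ∪ {r, s, d} : Set V)} => ends e.1) ω' q d ∧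
                (∀ x, x ≠ r → x ≠ s → x ≠ d →
                  (Conn (fun e : {e // e ∉ within ends (L ∪ {r, s, d} : Set V)} => ends e.1) ω' r x ∨ Conn (fun e : {e // e ∉ within ends (L ∪ {r, s, d} : Set V)} => ends e.1) ω' s x ∨ Conn (fun e : {e // e ∉ within ends (L ∪ {r, s, d} : Set V)} => ends e.1) ω' d x) →
                  x ∉ M2 (fun e : {e // e ∉ within ends (L ∪ {r, s, d} : Set V)} => ends e.1) r s ω') ∧
                d ∉ M2 (fun e : {e // e ∉ within ends (L ∪ {r, s, d} : Set V)} => ends e.1) r s ω') ∧ (Conn (fun e : {e // e ∉ within ends (L ∪ {r, s, d} : Set V)} => ends e.1) ω' r d ∨ Conn (fun e : {e // e ∉ within ends (L ∪ {r, s, d} : Set V)} => ends e.1) ω' s d) ∧ ((Conn (fun e : {e // e ∉ within ends (L ∪ {r, s, d} : Set V)} => ends e.1) (OneColourSwitch.compl ω') d p ∨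
                Conn (fun e : {e // e ∉ within ends (L ∪ {r, s, d} : Set V)} => ends e.1) (OneColourSwitch.compl ω') d q ∨
                ∃ x, x ≠ r ∧ x ≠ s ∧ x ≠ d ∧
                  (Conn (fun e : {e // e ∉ within ends (L ∪ {r, s, d} : Set V)} => ends e.1) ω' r x ∨ Conn (fun e : {e // e ∉ within ends (L ∪ {r, s, d} : Set V)} => ends e.1) ω' s x ∨ Conn (fun e : {e // e ∉ within ends (L ∪ {r, s, d} : Set V)} => ends e.1) ω' d x) ∧
                  Conn (fun e : {e // e ∉ within ends (L ∪ {r, s, d} : Set V)} => ends e.1) (OneColourSwitch.compl ω') d x) ∨ (∃ x ∈ L,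
                (Conn (fun e : {e // ¬ (e ∉ within ends (L ∪ {r, s, d} : Set V))} => ends e.1) τ r x ∨ Conn (fun e : {e // ¬ (e ∉ within ends (L ∪ {r, s, d} : Set V))} => ends e.1) τ s x ∨ Conn (fun e : {e // ¬ (e ∉ within ends (L ∪ {r, s, d} : Set V))} => ends e.1) τ d x) ∧
                Conn (fun e : {e // ¬ (e ∉ within ends (L ∪ {r, s, d} : Set V))} => ends e.1) (OneColourSwitch.compl τ) d x))) := by
        intro h; exact hc ⟨h.2.1, h.2.2⟩
      rw [if_neg hLn, if_neg hRn, if_neg hRn]; ring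
  · have hLn : ¬ (((sep2 (fun e : {e // e ∉ within ends (L ∪ {r, s, d} : Set V)} => ends e.1) p q r s ω' ∧
            ¬ Conn (fun e : {e // e ∉ within ends (L ∪ {r, s, d} : Set V)} => ends e.1) ω' p d ∧ ¬ Conn (fun e : {e // e ∉ within ends (L ∪ {r, s, d} : Set V)} => ends e.1) ω' q d ∧
            (∀ x, x ∉ L → x ≠ r → x ≠ s → x ≠ d →
              (Conn (fun e : {e // e ∉ within ends (L ∪ {r, s, d} : Set V)} => ends e.1) ω' r x ∨ Conn (fun e : {e // e ∉ within ends (L ∪ {r, s, d} : Set V)} => ends e.1) ω' s x ∨ Conn (fun e : {e // e ∉ within ends (L ∪ {r, s, d} : Set V)} => ends e.1) ω' d x) →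
              x ∉ M2 (fun e : {e // e ∉ within ends (L ∪ {r, s, d} : Set V)} => ends e.1) r s ω') ∧
            d ∉ M2 (fun e : {e // e ∉ within ends (L ∪ {r, s, d} : Set V)} => ends e.1) r s ω') ∧ (d ∉ M2 (fun e : {e // ¬ (e ∉ within ends (L ∪ {r, s, d} : Set V))} => ends e.1) r s τ ∧
            ∀ x ∈ L,
              (Conn (fun e : {e // ¬ (e ∉ within ends (L ∪ {r, s, d} : Set V))} => ends e.1) τ r x ∨ Conn (fun e : {e // ¬ (e ∉ within ends (L ∪ {r, s, d} : Set V))} => ends e.1) τ s x ∨ Conn (fun e : {e // ¬ (e ∉ within ends (L ∪ {r, s, d} : Set V))} => ends e.1) τ d x) →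
              x ∉ M2 (fun e : {e // ¬ (e ∉ within ends (L ∪ {r, s, d} : Set V))} => ends e.1) r s τ) ∧ (d ∈ K2 (fun e : {e // e ∉ within ends (L ∪ {r, s, d} : Set V)} => ends e.1) r s ω' ∨ d ∈ K2 (fun e : {e // ¬ (e ∉ within ends (L ∪ {r, s, d} : Set V))} => ends e.1) r s τ)) ∧ ((Conn (fun e : {e // e ∉ within ends (L ∪ {r, s, d} : Set V)} => ends e.1) (OneColourSwitch.compl ω') d p ∨
            Conn (fun e : {e // e ∉ within ends (L ∪ {r, s, d} : Set V)} => ends e.1) (OneColourSwitch.compl ω') d q ∨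
            ∃ x, x ≠ r ∧ x ≠ s ∧ x ≠ d ∧ x ∉ L ∧
              (Conn (fun e : {e // e ∉ within ends (L ∪ {r, s, d} : Set V)} => ends e.1) ω' r x ∨ Conn (fun e : {e // e ∉ within ends (L ∪ {r, s, d} : Set V)} => ends e.1) ω' s x ∨ Conn (fun e : {e // e ∉ within ends (L ∪ {r, s, d} : Set V)} => ends e.1) ω' d x) ∧
              Conn (fun e : {e // e ∉ within ends (L ∪ {r, s, d} : Set V)} => ends e.1) (OneColourSwitch.compl ω') d x) ∨ (∃ x ∈ L,
            (Conn (fun e : {e // ¬ (e ∉ within ends (L ∪ {r, s, d} : Set V))} => ends e.1) τ r x ∨ Conn (fun e : {e // ¬ (e ∉ within ends (L ∪ {r, s, d} : Set V))} => ends e.1) τ s x ∨ Conn (fun e : {e // ¬ (e ∉ within ends (L ∪ {r, s, d} : Set V))} => ends e.1) τ d x) ∧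
            Conn (fun e : {e // ¬ (e ∉ within ends (L ∪ {r, s, d} : Set V))} => ends e.1) (OneColourSwitch.compl τ) d x))) := by
      intro h; exact hΩ ((outside_iff_rsd hL hr hs hd).1 h.1.1)
    have hRn : ¬ ((sep2 (fun e : {e // e ∉ within ends (L ∪ {r, s, d} : Set V)} => ends e.1) p q r s ω' ∧
              ¬ Conn (fun e : {e // e ∉ within ends (L ∪ {r, s, d} : Set V)} => ends e.1) ω' p d ∧ ¬ Conn (fun e : {e // e ∉ within ends (L ∪ {r, s, d} : Set V)} => ends e.1) ω' q d ∧
              (∀ x, x ≠ r → x ≠ s → x ≠ d →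
                (Conn (fun e : {e // e ∉ within ends (L ∪ {r, s, d} : Set V)} => ends e.1) ω' r x ∨ Conn (fun e : {e // e ∉ within ends (L ∪ {r, s, d} : Set V)} => ends e.1) ω' s x ∨ Conn (fun e : {e // e ∉ within ends (L ∪ {r, s, d} : Set V)} => ends e.1) ω' d x) →
                x ∉ M2 (fun e : {e // e ∉ within ends (L ∪ {r, s, d} : Set V)} => ends e.1) r s ω') ∧
              d ∉ M2 (fun e : {e // e ∉ within ends (L ∪ {r, s, d} : Set V)} => ends e.1) r s ω') ∧ (Conn (fun e : {e // e ∉ within ends (L ∪ {r, s, d} : Set V)} => ends e.1) ω' r d ∨ Conn (fun e : {e // e ∉ within ends (L ∪ {r, s, d} : Set V)} => ends e.1) ω' s d) ∧ ((Conn (fun e : {e // e ∉ within ends (L ∪ {r, s, d} : Set V)} => ends e.1) (OneColourSwitch.compl ω') d p ∨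
              Conn (fun e : {e // e ∉ within ends (L ∪ {r, s, d} : Set V)} => ends e.1) (OneColourSwitch.compl ω') d q ∨
              ∃ x, x ≠ r ∧ x ≠ s ∧ x ≠ d ∧
                (Conn (fun e : {e // e ∉ within ends (L ∪ {r, s, d} : Set V)} => ends e.1) ω' r x ∨ Conn (fun e : {e // e ∉ within ends (L ∪ {r, s, d} : Set V)} => ends e.1) ω' s x ∨ Conn (fun e : {e // e ∉ within ends (L ∪ {r, s, d} : Set V)} => ends e.1) ω' d x) ∧
                Conn (fun e : {e // e ∉ within ends (L ∪ {r, s, d} : Set V)} => ends e.1) (OneColourSwitch.compl ω') d x) ∨ (∃ x ∈ L,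
              (Conn (fun e : {e // ¬ (e ∉ within ends (L ∪ {r, s, d} : Set V))} => ends e.1) τ r x ∨ Conn (fun e : {e // ¬ (e ∉ within ends (L ∪ {r, s, d} : Set V))} => ends e.1) τ s x ∨ Conn (fun e : {e // ¬ (e ∉ within ends (L ∪ {r, s, d} : Set V))} => ends e.1) τ d x) ∧
              Conn (fun e : {e // ¬ (e ∉ within ends (L ∪ {r, s, d} : Set V))} => ends e.1) (OneColourSwitch.compl τ) d x))) := by
      intro h; exact hΩ h.1
    rw [if_neg hLn, if_neg hRn, if_neg hRn]; ring

end Inner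

end NoPocket

end Summit.Ventures.PercRepro2
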